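import Literature.Combinatorics.StablePolynomials.ProperPosition
import Literature.Combinatorics.StablePolynomials.PderivProperPosition
import Literature.Combinatorics.StablePolynomials.Limits
import Literature.Combinatorics.StablePolynomials.SamePhase
import HarnessLib

/-!
# Proper position survives real specialization; consecutive coefficients of one variable are in proper
# position (Borcea–Brändén–Liggett, Remark 4.1 (second part) and the chain `P_0 ≪ P_1 ≪ ⋯ ≪ P_n` of Prop. 4.15)

J. Borcea, P. Brändén, T. M. Liggett, *Negative dependence and the geometry of polynomials*, J. Amer. Math.
Soc. 22 (2009) 521–567 (arXiv:0707.2340, held `paper:arxiv-0707.2340`; numbering of the arXiv version), §4.3.1.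
Verbatim:

> **Remark 4.1.** The typical proper position is between a real stable polynomial and any of its partial
> derivatives: if `f ∈ ℝ[z_1,…,z_n]` is real stable then `∂_j f ≪ f` for all `j ∈ [n]`. If `f ≪ g` and `α` is a
> real number then either `f(α, z_2, …, z_n) ≪ g(α, z_2, …, z_n)` or `f(α, z_2, …, z_n) = g(α, z_2, …, z_n) ≡ 0`,
> see [BBS2]. […]
> (proof of Proposition 4.15) We claim that the polynomial `f ∈ ℝ[z_1,…,z_n,y]` defined by
> `f(z,y) = […] := y^n P_0(z) + y^{n-1} P_1(z) + ⋯ + P_n(z)` is real stable with non-negative coefficients.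
> Assuming this claim we see that since `P_k(z) = (n-k)!⁻¹ ∂^{n-k} f/∂y^{n-k} |_{y=0}`, by Remark 4.1 we have that
> `det(I + AZ) = P_0 ≪ P_1 ≪ ⋯ ≪ P_n = det(I + BZ)`.

The first sentence of Remark 4.1 is the tree's `IsRealStable.isProperPosition_pderiv` (`PderivProperPosition.lean`).

## What is here

* §1 **`IsProperPosition.specialize`** — the second sentence, for any variable `z_i`: `f ≪ g` implies
  `f|_{z_i=α} ≪ g|_{z_i=α}` or both specializations vanish (`bind₁ (Function.update X i (C α))`). Proof as the
  equivalence (1) ⟺ (2) of Thm. 4.11 suggests: `g + z_{n+1} f` is real stable (tree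
  `isProperPosition_iff_isRealStable_add_X_mul`), real stability survives `z_i := α` or the polynomial dies (tree
  `IsUpperHalfPlaneStable.specialize_real`), and `z_i := α` commutes with adjoining `z_{n+1}`.
  `IsRealStable.specialize_pderiv_properPosition`: `(∂_i h)|_{z_i=α} ≪ h|_{z_i=α}` or both zero.
* §2 **`IsRealStable.coeff_optionEquivLeft_properPosition`** — the chain step of Prop. 4.15 in general: for a
  real stable `f ∈ ℝ[x_τ, x_n]` (`x_n` the variable `none` of `Option τ`) with `f = Σ_k x_n^k P_k(x')`
  (`P_k = (optionEquivLeft ℝ τ f).coeff k`), `P_{k+1} ≪ P_k` or `P_k = P_{k+1} = 0` (BBL index the `P_k` by the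
  co-degree `y^{n-k}`, whence their increasing chain). Route: `∂_y^k f` real stable or zero (tree
  `IsUpperHalfPlaneStable.iterate_pderiv`), §1 at `y = 0`, and `(∂_y^j f)(x', 0) = j! P_j(x')` (tree
  `eval_iterate_pderiv_none_zero`), the proper position being read off pointwise (`isProperPosition_iff_forall`,
  `isProperPosition_C_mul_iff`). The special case `f = f_H` is `isProperPosition_homogeneousComponent` of
  `Literature/Probability/NegativeDependence/TruncationStochasticDomination.lean`.

## References

* [BorceaBrandenLiggett2007] J. Borcea, P. Brändén, T. M. Liggett, Negative dependence and the geometry of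
  polynomials, J. Amer. Math. Soc. 22 (2009), 521–567; arXiv:0707.2340 — §4.3.1 Remark 4.1, proof of Prop. 4.15.
* [BorceaBranden2009] J. Borcea, P. Brändén, The Lee–Yang and Pólya–Schur programs I (Lemma 1.8 = BBL Thm. 4.11).
-/

noncomputable section

open MvPolynomial Finset

namespace Literature.Combinatorics.StablePolynomials

variable {σ : Type*} [Fintype σ] [DecidableEq σ]

/-! ## §1 Specializing one variable at a real number -/

section Specialize

omit [Fintype σ] in
/-- Specializing `z_i := α` commutes with adjoining the new variable `z_{n+1}`: on `rename some`.
[folklore] -/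
private theorem bind₁_update_some_rename_some (i : σ) (α : ℝ) (p : MvPolynomial σ ℝ) :
    bind₁ (Function.update X (some i) (C α) : Option σ → MvPolynomial (Option σ) ℝ) (rename some p) =
      rename some (bind₁ (Function.update X i (C α)) p) := by
  rw [bind₁_rename]
  induction p using MvPolynomial.induction_on with
  | C a => simp
  | add p q hp hq => simp only [map_add, hp, hq]
  | mul_X p j hp =>
    simp only [map_mul, hp, bind₁_X_right, Function.comp_apply]
    congr 1
    rcases eq_or_ne j i with rfl | hji
    · simp
    · rw [Function.update_of_ne (by simpa using hji), Function.update_of_ne hji, rename_X]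

omit [Fintype σ] in
/-- … and fixes the new variable. [folklore] -/
private theorem bind₁_update_some_X_none (i : σ) (α : ℝ) :
    bind₁ (Function.update X (some i) (C α) : Option σ → MvPolynomial (Option σ) ℝ) (X none) = X none := by
  rw [bind₁_X_right, Function.update_of_ne (Option.some_ne_none i).symm]

omit [Fintype σ] [DecidableEq σ] in
/-- `rename some g + X_{none} · rename some f = 0` forces `f = g = 0`. [folklore] -/
private theorem eq_zero_of_rename_add_X_mul_eq_zero {f g : MvPolynomial σ ℝ}
    (h : rename some g + X none * rename some f = (0 : MvPolynomial (Option σ) ℝ)) : f = 0 ∧ g = 0 := by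
  -- kill the new variable: `g = 0`
  have hg : g = 0 := by
    have := congrArg (bind₁ (fun o : Option σ => Option.elim o (0 : MvPolynomial σ ℝ) X)) h
    simp only [map_add, map_mul, bind₁_rename, bind₁_X_right, Option.elim_none, zero_mul, add_zero, map_zero,
      Function.comp_def, Option.elim_some] at this
    simpa using this
  refine ⟨?_, hg⟩
  rw [hg, map_zero, zero_add] at h
  rcases mul_eq_zero.1 h with hX | hf
  · exact absurd hX (X_ne_zero none)
  · exact rename_injective some (Option.some_injective σ) (by rw [hf, map_zero])

omit [Fintype σ] in
/-- Complexifying the specialization map. [folklore] -/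
private theorem map_update_X_C (i : σ) (α : ℝ) :
    (fun j => MvPolynomial.map (algebraMap ℝ ℂ) (Function.update X i (C α) j)) =
      Function.update X i (C ((α : ℝ) : ℂ)) := by
  funext j
  rcases eq_or_ne j i with rfl | hj
  · simp
  · rw [Function.update_of_ne hj, Function.update_of_ne hj, map_X]

omit [Fintype σ] in
/-- Evaluating a complexified specialization: `(q|_{z_i = α})(w) = q(w with w_i := α)`. [folklore] -/
private theorem eval_map_bind₁_update (q : MvPolynomial σ ℝ) (i : σ) (α : ℝ) (w : σ → ℂ) :
    eval w (MvPolynomial.map (algebraMap ℝ ℂ) (bind₁ (Function.update X i (C α)) q)) =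
      eval (Function.update w i (α : ℂ)) (MvPolynomial.map (algebraMap ℝ ℂ) q) := by
  rw [map_bind₁, map_update_X_C, eval_bind₁_update]

/-- **Borcea–Brändén–Liggett, Remark 4.1 (second part).** "If `f ≪ g` and `α` is a real number then either
`f(α, z_2, …, z_n) ≪ g(α, z_2, …, z_n)` or `f(α, z_2, …, z_n) = g(α, z_2, …, z_n) ≡ 0`, see [BBS2]" — for any
variable `z_i`. Proof: `f ≪ g` iff `g + z_{n+1} f` is real stable (Thm. 4.11, tree
`isProperPosition_iff_isRealStable_add_X_mul`); real stability survives `z_i := α` or the polynomial dies (tree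
`IsUpperHalfPlaneStable.specialize_real`). [cite: BorceaBrandenLiggett2007, §4.3.1 Remark 4.1] -/
theorem IsProperPosition.specialize {f g : MvPolynomial σ ℝ} (h : IsProperPosition f g) (i : σ) (α : ℝ) :
    (bind₁ (Function.update X i (C α)) f = 0 ∧ bind₁ (Function.update X i (C α)) g = 0) ∨
      IsProperPosition (bind₁ (Function.update X i (C α)) f) (bind₁ (Function.update X i (C α)) g) := by
  classical
  set H : MvPolynomial (Option σ) ℝ := rename some g + X none * rename some f with hH
  have hHst : IsRealStable H := (isProperPosition_iff_isRealStable_add_X_mul f g).1 h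
  set φ : Option σ → MvPolynomial (Option σ) ℝ := Function.update X (some i) (C α) with hφ
  have hS : bind₁ φ H = rename some (bind₁ (Function.update X i (C α)) g) +
      X none * rename some (bind₁ (Function.update X i (C α)) f) := by
    rw [hH, map_add, map_mul, hφ, bind₁_update_some_rename_some, bind₁_update_some_rename_some,
      bind₁_update_some_X_none]
  -- over `ℂ`: the specialization is zero or stable
  have hmap : MvPolynomial.map (algebraMap ℝ ℂ) (bind₁ φ H) =
      bind₁ (Function.update X (some i) (C ((α : ℝ) : ℂ))) (MvPolynomial.map (algebraMap ℝ ℂ) H) := by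
    rw [map_bind₁, hφ, map_update_X_C]
  rcases hHst.specialize_real (some i) α with h0 | hst
  · left
    rw [← hmap] at h0
    have hS0 : bind₁ φ H = 0 := MvPolynomial.map_injective _ (RingHom.injective _) (by rw [h0, map_zero])
    rw [hS] at hS0
    exact eq_zero_of_rename_add_X_mul_eq_zero hS0
  · right
    rw [isProperPosition_iff_isRealStable_add_X_mul, ← hS, IsRealStable, hmap]
    exact hst

/-- **Remark 4.1, typical use**: for real stable `h`, `(∂_i h)|_{z_i = α} ≪ h|_{z_i = α}` or both vanish (first
part: `∂_i h ≪ h`, tree `IsRealStable.isProperPosition_pderiv`). [cite: BorceaBrandenLiggett2007, §4.3.1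
Remark 4.1] -/
theorem IsRealStable.specialize_pderiv_properPosition {h : MvPolynomial σ ℝ} (hh : IsRealStable h) (i : σ)
    (α : ℝ) :
    (bind₁ (Function.update X i (C α)) (pderiv i h) = 0 ∧ bind₁ (Function.update X i (C α)) h = 0) ∨
      IsProperPosition (bind₁ (Function.update X i (C α)) (pderiv i h)) (bind₁ (Function.update X i (C α)) h) :=
  (hh.isProperPosition_pderiv i).specialize i α

end Specialize

/-! ## §2 Consecutive coefficients of one variable are in proper position -/

section Coefficients

variable {τ : Type*} [Fintype τ] [DecidableEq τ]

omit [Fintype τ] [DecidableEq τ] in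
/-- Renaming along `some` reflects and preserves stability. [folklore] -/
private theorem isUpperHalfPlaneStable_rename_some_iff (p : MvPolynomial τ ℂ) :
    IsUpperHalfPlaneStable (rename (some : τ → Option τ) p) ↔ IsUpperHalfPlaneStable p := by
  refine ⟨fun h z hz => ?_, fun h => h.rename some⟩
  have := h (fun o => Option.elim o Complex.I z) (by rintro (_ | j) <;> simp [hz])
  rwa [eval_rename, show ((fun o : Option τ => Option.elim o Complex.I z) ∘ some) = z from rfl] at this

omit [Fintype τ] [DecidableEq τ] in
/-- Proper position is invariant under `rename some`. [folklore] -/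
private theorem isProperPosition_rename_some_iff (f g : MvPolynomial τ ℝ) :
    IsProperPosition (rename (some : τ → Option τ) f) (rename some g) ↔ IsProperPosition f g := by
  rw [IsProperPosition, IsProperPosition, map_rename, map_rename, ← isUpperHalfPlaneStable_rename_some_iff
    (MvPolynomial.map (algebraMap ℝ ℂ) g + C Complex.I * MvPolynomial.map (algebraMap ℝ ℂ) f)]
  simp only [map_add, map_mul, rename_C]

/-- **Coefficients of consecutive powers of one variable of a real stable polynomial are in proper position**:
writing `f = Σ_k x_n^k P_k(x')` (`P_k = (optionEquivLeft f).coeff k`), `P_{k+1} ≪ P_k` unless both vanish — the step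
"since `P_k(z) = (n-k)!⁻¹ ∂^{n-k} f/∂y^{n-k} |_{y=0}`, by Remark 4.1 we have that `P_0 ≪ P_1 ≪ ⋯ ≪ P_n`" of the
proof of Prop. 4.15 (there `P_k` multiplies `y^{n-k}`, so the indexing is reversed). Proof: `∂_y^k f` is real stable
or zero; apply Remark 4.1 at `y = 0` and read off `(∂_y^k f)|_{y=0} = k! P_k`, `(∂_y^{k+1} f)|_{y=0} = (k+1)! P_{k+1}`
(evaluated through the tree's `eval_iterate_pderiv_none_zero`). [cite: BorceaBrandenLiggett2007, §4.3.1 proof of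
Prop. 4.15 (with Remark 4.1)] -/
theorem IsRealStable.coeff_optionEquivLeft_properPosition {f : MvPolynomial (Option τ) ℝ} (hf : IsRealStable f)
    (k : ℕ) :
    ((optionEquivLeft ℝ τ f).coeff (k + 1) = 0 ∧ (optionEquivLeft ℝ τ f).coeff k = 0) ∨
      IsProperPosition ((optionEquivLeft ℝ τ f).coeff (k + 1)) ((optionEquivLeft ℝ τ f).coeff k) := by
  classical
  set g := (pderiv none)^[k] f with hg
  set Pk := (optionEquivLeft ℝ τ f).coeff k with hPk
  set Pk1 := (optionEquivLeft ℝ τ f).coeff (k + 1) with hPk1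
  -- evaluation of `∂_y^j f` on the slice `y = 0`, over `ℂ`
  have hcomm : ∀ j : ℕ, MvPolynomial.map (algebraMap ℝ ℂ) ((pderiv none)^[j] f) =
      (pderiv none)^[j] (MvPolynomial.map (algebraMap ℝ ℂ) f) := by
    intro j
    induction j with
    | zero => rfl
    | succ j ih => rw [Function.iterate_succ_apply', Function.iterate_succ_apply', ← pderiv_map, ih]
  have hcoeff : ∀ j : ℕ, (optionEquivLeft ℂ τ (MvPolynomial.map (algebraMap ℝ ℂ) f)).coeff j =
      MvPolynomial.map (algebraMap ℝ ℂ) ((optionEquivLeft ℝ τ f).coeff j) := by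
    intro j
    ext m
    rw [optionEquivLeft_coeff_coeff, coeff_map, coeff_map, optionEquivLeft_coeff_coeff]
  have hval : ∀ (j : ℕ) (z : τ → ℂ), eval (fun o => Option.elim o 0 z)
      (MvPolynomial.map (algebraMap ℝ ℂ) ((pderiv none)^[j] f)) =
      (j.factorial : ℂ) * eval z (MvPolynomial.map (algebraMap ℝ ℂ) ((optionEquivLeft ℝ τ f).coeff j)) := by
    intro j z
    rw [hcomm, eval_iterate_pderiv_none_zero, hcoeff]
  -- the pair `∂_y g`, `g` on the slice
  have hGval : ∀ z : τ → ℂ, eval (fun o => Option.elim o 0 z)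
      (MvPolynomial.map (algebraMap ℝ ℂ) g + C Complex.I * MvPolynomial.map (algebraMap ℝ ℂ) (pderiv none g)) =
      (k.factorial : ℂ) * eval z (MvPolynomial.map (algebraMap ℝ ℂ) Pk) +
        Complex.I * (((k + 1).factorial : ℂ) * eval z (MvPolynomial.map (algebraMap ℝ ℂ) Pk1)) := by
    intro z
    have h1 : pderiv none g = (pderiv none)^[k + 1] f := by rw [Function.iterate_succ_apply', hg]
    rw [map_add, map_mul, eval_C, hg, hval, h1, hval]
  have hupd : ∀ z : τ → ℂ, Function.update (fun o : Option τ => Option.elim o Complex.I z) none 0 =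
      fun o => Option.elim o 0 z := by
    intro z; funext o; rcases o with _ | j <;> simp
  -- zero alternative from identically vanishing slice values
  have hzero : (∀ z : τ → ℂ, (k.factorial : ℂ) * eval z (MvPolynomial.map (algebraMap ℝ ℂ) Pk) +
      Complex.I * (((k + 1).factorial : ℂ) * eval z (MvPolynomial.map (algebraMap ℝ ℂ) Pk1)) = 0) →
      Pk1 = 0 ∧ Pk = 0 := by
    intro hz
    have hP : C ((k.factorial : ℝ) : ℂ) * MvPolynomial.map (algebraMap ℝ ℂ) Pk +
        C (Complex.I * ((k + 1).factorial : ℝ)) * MvPolynomial.map (algebraMap ℝ ℂ) Pk1 = 0 := by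
      refine MvPolynomial.funext fun z => ?_
      rw [map_add, map_mul, map_mul, eval_C, eval_C, map_zero, mul_assoc]
      exact_mod_cast hz z
    have hc : ∀ m, ((k.factorial : ℝ) : ℂ) * ((coeff m Pk : ℝ) : ℂ) +
        Complex.I * ((k + 1).factorial : ℝ) * ((coeff m Pk1 : ℝ) : ℂ) = 0 := by
      intro m
      have := congrArg (coeff m) hP
      simpa only [coeff_add, coeff_C_mul, coeff_map, coeff_zero, Complex.coe_algebraMap] using this
    have hk0 : (k.factorial : ℝ) ≠ 0 := Nat.cast_ne_zero.2 (Nat.factorial_ne_zero k)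
    have hk1 : ((k + 1).factorial : ℝ) ≠ 0 := Nat.cast_ne_zero.2 (Nat.factorial_ne_zero (k + 1))
    constructor
    · ext m
      have h1 := congrArg Complex.im (hc m)
      simp only [Complex.add_im, Complex.mul_im, Complex.ofReal_re, Complex.ofReal_im, mul_zero, zero_mul, add_zero,
        Complex.I_re, Complex.I_im, Complex.mul_re, one_mul, sub_zero, zero_add, Complex.zero_im] at h1
      rw [coeff_zero]
      have : ((k + 1).factorial : ℝ) * coeff m Pk1 = 0 := by linarith
      exact (mul_eq_zero.1 this).resolve_left hk1
    · ext m
      have h1 := congrArg Complex.re (hc m)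
      simp only [Complex.add_re, Complex.mul_re, Complex.ofReal_re, Complex.ofReal_im, mul_zero, sub_zero,
        Complex.I_re, Complex.I_im, zero_mul, one_mul, Complex.mul_im, add_zero, Complex.zero_re] at h1
      rw [coeff_zero]
      have : (k.factorial : ℝ) * coeff m Pk = 0 := by linarith
      exact (mul_eq_zero.1 this).resolve_left hk0
  by_cases hg0 : g = 0
  · left
    refine hzero fun z => ?_
    rw [← hGval, hg0]
    simp
  · have hgst : IsRealStable g := by
      have h := (IsUpperHalfPlaneStable.iterate_pderiv hf none k).resolve_left ?_
      · rw [IsRealStable, hg, hcomm]; exact h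
      · intro h0
        apply hg0
        rw [← hcomm] at h0
        exact MvPolynomial.map_injective _ (RingHom.injective _) (by rw [h0, map_zero])
    -- Remark 4.1 at `y = 0`
    rcases hgst.specialize_pderiv_properPosition none 0 with ⟨h1, h2⟩ | hpp
    · left
      refine hzero fun z => ?_
      have e1 : eval (fun o => Option.elim o 0 z) (MvPolynomial.map (algebraMap ℝ ℂ) g) = 0 := by
        have := congrArg (fun q => eval (fun o => Option.elim o Complex.I z) (MvPolynomial.map (algebraMap ℝ ℂ) q)) h2
        rw [eval_map_bind₁_update, Complex.ofReal_zero, hupd, map_zero, map_zero] at this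
        exact this
      have e2 : eval (fun o => Option.elim o 0 z) (MvPolynomial.map (algebraMap ℝ ℂ) (pderiv none g)) = 0 := by
        have := congrArg (fun q => eval (fun o => Option.elim o Complex.I z) (MvPolynomial.map (algebraMap ℝ ℂ) q)) h1
        rw [eval_map_bind₁_update, Complex.ofReal_zero, hupd, map_zero, map_zero] at this
        exact this
      rw [← hGval, map_add, map_mul, eval_C, e1, e2, mul_zero, add_zero]
    · right
      -- transfer the proper position of the specializations to the coefficient polynomials, pointwise
      have key : IsProperPosition (C (((k + 1).factorial : ℝ)) * Pk1) (C ((k.factorial : ℝ)) * Pk) := by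
        rw [isProperPosition_iff_forall]
        intro z hz
        have h := (isProperPosition_iff_forall _ _).1 hpp (fun o => Option.elim o Complex.I z)
          (by rintro (_ | j) <;> simp [hz])
        rw [eval_map_bind₁_update, eval_map_bind₁_update, Complex.ofReal_zero, hupd, hg] at h
        have h1 : pderiv none ((pderiv none)^[k] f) = (pderiv none)^[k + 1] f := by
          rw [Function.iterate_succ_apply']
        rw [h1, hval, hval] at h
        simpa only [map_mul, map_C, eval_C, Complex.coe_algebraMap, Complex.ofReal_natCast] using h
      exact (isProperPosition_C_mul_iff (by exact_mod_cast Nat.factorial_pos (k + 1))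
        (by exact_mod_cast Nat.factorial_pos k) _ _).1 key

end Coefficients

end Literature.Combinatorics.StablePolynomials

end
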